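import Mathlib
import HarnessLib
import Summits.NavierStokesRegularity.NavierStokesRegularity.Theorems.PoloidalWindowDoorLrcModEntireCurvedTimeWebAtZero
import Summits.NavierStokesRegularity.NavierStokesRegularity.Theorems.PoloidalWindowDoorLrcModEntireCurvedRidgeAnalytic
import Summits.NavierStokesRegularity.NavierStokesRegularity.Theorems.PoloidalWindowDoorLrcModEntireCurvedWebWindowSelect
import Summits.NavierStokesRegularity.NavierStokesRegularity.Theorems.PoloidalWindowDoorLrcModEntireCurvedEndKillFree
import Summits.NavierStokesRegularity.NavierStokesRegularity.Theorems.PoloidalWindowDoorLrcModEntireCurvedTimeSplitLocal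

/-!
# Route `PoloidalWindowDoor`, item `LrcModEntire` (stmt-NavierStokesRegularity-20428), cell (Q4-curved) of the (TH) column —
# ★★★ THE NON-VERTICAL CHILD OF `stub_Q4curvedAperiodic` AT BASE TIME `0`, IN PACKAGE CURRENCY (B-TWP0c assembled with port-2 g9's literal-free kill)

Cell ns-regularity-ideate, stub-worker seat ns-poloidal-K2-p2 g18 under the LEAD of item 20428 (ns-poloidal-K2-p3 g18);
`--supports stmt-NavierStokesRegularity-20428 --as helper`.  Memo `Cruxes/LrcModEntire/TOWER-CLOSES-port2g9.md` §D/§E; this seat's bus DESIGN NOTE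
2026-08-30T01:55:49Z (split at `τ = 0`).  ★★★ `q4curved_nonvertical_core`: the (Q4) binders over the curved hot branch (hypotheses of
`…CurvedTimeWebAt.curved_time_web_package` VERBATIM) + `δ ≤ 1/2` + the NON-SONIC binder literal + the APERIODIC binder literal + the NON-VERTICAL literal
«¬ ∃ δᵥ > 0, ∀ s z, |z| < δᵥ → σ·U₂(−1)(Γ s + z·e₂) = R(0,z)» ⊢ `False`:
`…CurvedTimeWebAtZero.curved_timeWeb_at_zero` (δ′, n₀, κt, k, d; local END′ clauses) → the literal gives `d ≢ 0` near `0` (value law + parallel webs) →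
`…CurvedRidgeAnalytic.ridgeHeight_analyticOnNhd_height_curved` (`R(0,·)` analytic on `(−δ,δ)`) → for each base point `σ₀`:
`…CurvedWebWindowSelect.exists_tower_window` (a height window in `(−ε₁, ε₁)` with `d′ ≠ 0`, `R″(0,·) ≠ 0`) → port-2 g9's
`…CurvedEndKillFree.curvature_deriv_zero_at_free` at `τ₁ := 0`, `G₁ := n₀` (`∂_z n₀ = d′` by `…CurvedTimeSplitLocal.fderiv_z_eq_deriv_of_pin_on`) ⇒
`k′(σ₀) = 0`; so `k` is constant, `⟪Γ″, νΓ⟫ = k` has period `1`, contradicting aperiodicity.  The registry-currency closer of the v16 child is then the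
12-line destructuring of `…Q4CurvedPeriodicStub`.

WHAT THIS IS NOT: not a claim about Navier–Stokes regularity; closes no registered slot by itself (the v16 child is the LEAD's to key); the VERTICAL
residue (`σ·U₂(−1)` constant along `Γ` at every small height) stays open; items 20428 / 19708 / 27893 OPEN (bears_on LADDER-NS N0).
-/

noncomputable section

set_option linter.dupNamespace false
set_option linter.style.longLine false

namespace Summit.NavierStokesRegularity.NavierStokesRegularity.Theorems.PoloidalWindowDoorLrcModEntireQ4CurvedNonvertical

open Set Function Filter Topology Metric
open scoped RealInnerProductSpace InnerProductSpace Laplacian ContDiff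
open Literature.Analysis Literature.Analysis.FluidPDE Literature.Analysis.UnboundedOperators
open Summit.NavierStokesRegularity.NavierStokesRegularity.Theorems
open Summit.NavierStokesRegularity.NavierStokesRegularity.Theorems.PoloidalWindowDoorLrcModEntireSheetFlattenTools
open Summit.NavierStokesRegularity.NavierStokesRegularity.Theorems.PoloidalWindowDoorLrcModEntireRidgeGlobalBranchODE
open Summit.NavierStokesRegularity.NavierStokesRegularity.Theorems.PoloidalWindowDoorLrcModEntireRidgeGlobalBranchFrame
open Summit.NavierStokesRegularity.NavierStokesRegularity.Theorems.PoloidalWindowDoorLrcModEntirePlanarCurveRigidity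
open Summit.NavierStokesRegularity.NavierStokesRegularity.Theorems.PoloidalWindowDoorLrcModEntireCurvedTimeWebAtZero
open Summit.NavierStokesRegularity.NavierStokesRegularity.Theorems.PoloidalWindowDoorLrcModEntireCurvedRidgeAnalytic
open Summit.NavierStokesRegularity.NavierStokesRegularity.Theorems.PoloidalWindowDoorLrcModEntireCurvedWebWindowSelect
open Summit.NavierStokesRegularity.NavierStokesRegularity.Theorems.PoloidalWindowDoorLrcModEntireCurvedEndKillFree
open Summit.NavierStokesRegularity.NavierStokesRegularity.Theorems.PoloidalWindowDoorLrcModEntireCurvedTimeSplitLocal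

/-- ★★★ **THE NON-VERTICAL CHILD OF THE (Q4-CURVED-APERIODIC) CELL IS EMPTY** (package currency).  See the module docstring. -/
theorem q4curved_nonvertical_core {C : ℝ} {U : ℝ → EuclideanSpace ℝ (Fin 3) → EuclideanSpace ℝ (Fin 3)} {Γ νΓ : ℝ → EuclideanSpace ℝ (Fin 3)} {R μ : ℝ → ℝ → ℝ}
    {σ κ r δ ρ : ℝ}
    (hUrate : HasTypeITimeDecay C U) (hUcont : ContinuousOn (uncurry U) (Iio (0 : ℝ) ×ˢ univ))
    (hUmild : ∀ s t : ℝ, s < t → t < 0 → ∀ x, U t x = heatExtension (U s) (t - s) x - oseenDuhamel 1 s U U t x)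
    (hUdiv : ∀ t < 0, VectorCalculus.IsDivFree (U t))
    (hUpol : ∀ s < 0, ∀ q, ⟪curl (U s) q, EuclideanSpace.single 2 1⟫_ℝ = 0)
    (hUne : U (-1) 0 2 ≠ 0) (hUhotbd : ∀ t < 0, ∀ x, Real.sqrt (-t) * |U t x 2| ≤ |U (-1) 0 2|)
    (hUcrit : ∀ y ∈ {y : EuclideanSpace ℝ (Fin 3) | y 2 = 0 ∧ U (-1) y 2 = U (-1) 0 2}, fderiv ℝ (fun x => U (-1) x 2) y = 0)
    (hσ : σ = 1 ∨ σ = -1) (hσN : σ * U (-1) 0 2 = |U (-1) 0 2|) (hκ : 0 < κ)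
    (hΓ : ContDiff ℝ ∞ Γ) (hΓ2 : ∀ s, Γ s 2 = 0) (hΓunit : ∀ s, ‖deriv Γ s‖ = 1) (hΓhot : ∀ s, U (-1) (Γ s) 2 = U (-1) 0 2)
    (hν : ∀ s, νΓ s = WithLp.toLp 2 ![-(deriv Γ s 1), deriv Γ s 0, 0])
    (hΓcurv : ∀ s, κ ≤ -(fderiv ℝ (fderiv ℝ (fun y => σ * U (-1) y 2)) (Γ s) (νΓ s) (νΓ s)))
    (hr : 0 < r) (hδ : 0 < δ)
    (hconc : ∀ τ z : ℝ, |τ| < δ → |z| < δ → ∀ s : ℝ, ∀ n ∈ Ioo (-r) r,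
      fderiv ℝ (fderiv ℝ (fun y => σ * U (-1 + τ) y 2)) (Γ s + n • νΓ s + z • EuclideanSpace.single 2 (1 : ℝ)) (νΓ s) (νΓ s) < 0)
    (hweb : ∀ τ₀ z₀ : ℝ, |τ₀| < δ → |z₀| < δ → ∀ s₀ : ℝ, ∃ n₀ ∈ Ioo (-r) r,
      σ * U (-1 + τ₀) (Γ s₀ + n₀ • νΓ s₀ + z₀ • EuclideanSpace.single 2 (1 : ℝ)) 2 = R τ₀ z₀ ∧
      (∀ n ∈ Icc (-r) r, n ≠ n₀ → σ * U (-1 + τ₀) (Γ s₀ + n • νΓ s₀ + z₀ • EuclideanSpace.single 2 (1 : ℝ)) 2 < R τ₀ z₀) ∧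
      DifferentiableAt ℝ (uncurry R) (τ₀, z₀) ∧
      fderiv ℝ (uncurry fun τ y => σ * U (-1 + τ) y 2) (τ₀, Γ s₀ + n₀ • νΓ s₀ + z₀ • EuclideanSpace.single 2 (1 : ℝ)) =
        (fderiv ℝ (uncurry R) (τ₀, z₀)).comp
          ((ContinuousLinearMap.fst ℝ ℝ (EuclideanSpace ℝ (Fin 3))).prod
            ((EuclideanSpace.proj (2 : Fin 3)).comp (ContinuousLinearMap.snd ℝ ℝ (EuclideanSpace ℝ (Fin 3))))))
    (hρ : 0 < ρ) (hμ3 : ContDiff ℝ 3 (uncurry μ))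
    (hslabU : ∀ t : ℝ, |t + 1| < ρ → ∀ x : EuclideanSpace ℝ (Fin 3), |x 2| < ρ → ∀ b : Fin 3, b ≠ 2 →
      fderiv ℝ (U t) x (EuclideanSpace.single 2 1) b = μ t (x 2) * fderiv ℝ (U t) x (EuclideanSpace.single b 1) 2)
    (hevU : ∀ t₀ : ℝ, |t₀ + 1| < ρ → ∀ y₀ : EuclideanSpace ℝ (Fin 3), y₀ 2 = 0 →
      ∀ᶠ z in 𝓝 ((t₀, y₀) : ℝ × EuclideanSpace ℝ (Fin 3)), ∀ b : Fin 3, b ≠ 2 →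
        fderiv ℝ (U z.1) z.2 (EuclideanSpace.single 2 1) b = μ z.1 (z.2 2) * fderiv ℝ (U z.1) z.2 (EuclideanSpace.single b 1) 2)
    (hδh : δ ≤ 1 / 2)
    (hns : ¬ (∃ a b : ℝ, ∀ z : ℝ, |z| < δ → R 0 z = a + b * z))
    (haper : ¬ (∃ L : ℝ, L ≠ 0 ∧ ∀ s : ℝ, ⟪deriv (deriv Γ) (s + L), νΓ (s + L)⟫_ℝ = ⟪deriv (deriv Γ) s, νΓ s⟫_ℝ))
    (hNV : ¬ (∃ δᵥ : ℝ, 0 < δᵥ ∧ ∀ s z : ℝ, |z| < δᵥ → σ * U (-1) (Γ s + z • EuclideanSpace.single 2 (1 : ℝ)) 2 = R 0 z)) :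
    False := by
  obtain ⟨δ', n₀, κt, k, d, K, hδ', hδ'δ, hδ'ρ, hδ'h, hfr, hkC, -, hd0, hdOn, -, hκt, hμ1, hbox, hpar, hloc⟩ :=
    curved_timeWeb_at_zero hUrate hUcont hUmild hUdiv hUpol hUne hUhotbd hUcrit hσ hσN hκ hΓ hΓ2 hΓunit hΓhot hν hΓcurv hr hδ hconc hweb hρ hμ3
      hslabU hevU
  have h0δ' : |(0 : ℝ)| < δ' := by simpa using hδ'
  have h0δ : |(0 : ℝ)| < δ := by simpa using hδ
  /- STEP 1: the non-vertical literal ⇒ the parallel offset is not identically zero near `0` -/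
  have hnv : ∀ ε : ℝ, 0 < ε → ∃ z : ℝ, |z| < ε ∧ d z ≠ 0 := by
    intro ε hε
    by_contra hall
    push Not at hall
    apply hNV
    refine ⟨min ε δ', lt_min hε hδ', fun s z hz => ?_⟩
    have hzε : |z| < ε := lt_of_lt_of_le hz (min_le_left _ _)
    have hzδ : |z| < δ' := lt_of_lt_of_le hz (min_le_right _ _)
    have hval := (hbox ((0 : ℝ), s, z) h0δ' hzδ).2.1
    simp only at hval
    rw [hpar s z hzδ, hall z hzε, zero_smul, add_zero, add_zero] at hval
    exact hval
  /- STEP 2: `R(0,·)` is real-analytic on `(−δ, δ)` -/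
  have hRan : AnalyticOnNhd ℝ (R 0) (Ioo (-δ) δ) := ridgeHeight_analyticOnNhd_height_curved hUrate hUcont hUmild hUdiv hΓ hν hδh hconc hweb h0δ
  have hd1 : ContDiffOn ℝ 1 d (Ioo (-δ') δ') := hdOn.of_le (by norm_cast)
  have hdd : ∀ z ∈ Ioo (-δ') δ', DifferentiableAt ℝ d z := fun z hz =>
    (hd1.differentiableOn one_ne_zero z hz).differentiableAt (isOpen_Ioo.mem_nhds hz)
  /- STEP 3: at every base point the tower kills `k′` -/
  have hk' : ∀ σ₀ : ℝ, deriv k σ₀ = 0 := by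
    intro σ₀
    obtain ⟨ε₁, hε₁, hε₁δ, hG, hq, hparr⟩ := hloc σ₀
    obtain ⟨a, b, hab, hIε, hd', -, hR''⟩ := exists_tower_window hδ'δ hd1 hd0 hnv hRan hns hε₁ hε₁δ
    have hIε₁ : ∀ z ∈ Ioo a b, |z| < ε₁ := fun z hz => by have h := hIε hz; exact abs_lt.2 ⟨h.1, h.2⟩
    -- the box and the pin in port-2's currency
    have hOo : IsOpen {q : ℝ × ℝ × ℝ | |q.1| < ε₁ ∧ |q.2.1 - σ₀| < ε₁ ∧ |q.2.2| < ε₁} :=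
      (isOpen_lt continuous_fst.abs continuous_const).inter
        ((isOpen_lt ((continuous_fst.comp continuous_snd).sub continuous_const).abs continuous_const).inter
          (isOpen_lt (continuous_snd.comp continuous_snd).abs continuous_const))
    have hSo : IsOpen {s : ℝ | |s - σ₀| < ε₁} := isOpen_lt (continuous_id.sub continuous_const).abs continuous_const
    have hpin : ∀ s ∈ {s : ℝ | |s - σ₀| < ε₁}, ∀ z ∈ Ioo (-ε₁) ε₁, n₀ (0, s, z) = d z := fun s _ z hz =>
      hpar s z (lt_of_lt_of_le (abs_lt.2 ⟨hz.1, hz.2⟩) hε₁δ)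
    have hddε : ∀ z ∈ Ioo (-ε₁) ε₁, DifferentiableAt ℝ d z := fun z hz => hdd z ⟨by linarith [hz.1, hε₁δ], by linarith [hz.2, hε₁δ]⟩
    have hwin : ∀ z ∈ Ioo a b, fderiv ℝ n₀ ((0 : ℝ), σ₀, z) ((0 : ℝ), (0 : ℝ), (1 : ℝ)) ≠ 0 ∧ deriv (deriv (R 0)) z ≠ 0 := by
      intro z hz
      refine ⟨?_, hR'' z hz⟩
      have hzε := hIε hz
      rw [fderiv_z_eq_deriv_of_pin_on (O := {q : ℝ × ℝ × ℝ | |q.1| < ε₁ ∧ |q.2.1 - σ₀| < ε₁ ∧ |q.2.2| < ε₁}) (S := {s : ℝ | |s - σ₀| < ε₁})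
        (I := Ioo (-ε₁) ε₁) (d := d) hOo (hG.of_le (by norm_cast)) isOpen_Ioo hpin hddε (by simpa using hε₁) hzε
        ⟨by simpa using hε₁, by simpa using hε₁, abs_lt.2 ⟨hzε.1, hzε.2⟩⟩]
      exact hd' z hz
    -- port-2's box spelling `|q.1 - τ₁|` at `τ₁ = 0`
    have hG' : ContDiffOn ℝ ∞ n₀ {q : ℝ × ℝ × ℝ | |q.1 - 0| < ε₁ ∧ |q.2.1 - σ₀| < ε₁ ∧ |q.2.2| < ε₁} := by
      simpa only [sub_zero] using hG
    exact curvature_deriv_zero_at_free hUrate hUcont hUmild hUdiv hUpol hμ3 hslabU hσ hδ'ρ hδ'h hκt hμ1 (τ₁ := 0) h0δ' hΓ hΓ2 hΓunit hkC hfr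
      hε₁ hG' (fun q h1 h2 h3 => hq q (by simpa only [sub_zero] using h1) h2 h3) hparr hab hIε₁ hwin
  /- STEP 4: `k` is constant ⇒ the signed curvature `⟪Γ″, νΓ⟫ = k` has period `1` — contradiction -/
  have hkconst : ∀ s, k s = k 0 := fun s => is_const_of_deriv_eq_zero (hkC.differentiable (by simp)) hk' s 0
  have hinner : ∀ s, ⟪deriv (deriv Γ) s, νΓ s⟫_ℝ = k s := by
    intro s
    have hνJ : νΓ s = rotJ (deriv Γ s) := by rw [hν s]; rfl
    have hT2 : deriv Γ s 2 = 0 := (deriv_horizontal (hΓ.of_le (by norm_cast)) hΓ2 s).1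
    rw [hfr s, hνJ, real_inner_smul_left, real_inner_self_eq_norm_sq, (rotJ_facts hT2 (hΓunit s)).2.1]; ring
  exact haper ⟨1, one_ne_zero, fun s => by rw [hinner, hinner, hkconst (s + 1), hkconst s]⟩

end Summit.NavierStokesRegularity.NavierStokesRegularity.Theorems.PoloidalWindowDoorLrcModEntireQ4CurvedNonvertical

end
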